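import Mathlib.Algebra.BigOperators.Intervals
import Mathlib.RingTheory.Ideal.Operations
import Mathlib.Tactic.LinearCombination
import Mathlib.Tactic.IntervalCases
import Mathlib.Tactic.Ring
import HarnessLib

/-!
# Sprung's Tandem Lemma as an exact two-term recursion (algebra over a commutative ring)

F. Sprung, *On pairs of `p`-adic `L`-functions for weight-two modular forms*, Algebra Number Theory 11
(2017) [Sprung2017], §4: from a queue sequence `(Θ_n)` (`π Θ_n = a_p Θ_{n−1} − ν Θ_{n−2}`, Def. 1.7)
the Tandem Lemma (Prop. 4.1) and Cor. 4.4 produce vectors `Υ_n ∈ Λ_n^{⊕2}` with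
`(Θ_n, νΘ_{n−1}) = Υ_n 𝒞_1⋯𝒞_n Ã⁻¹`, whose limit is the pair `(L♯, L♭)` (Thm. 1.12). Sprung proves
Prop. 4.1 by evaluating at `p`-power roots of unity and passes to the limit through the matrix
`𝓛og_{α,β}` over `ℂ_p`. This file gives an ELEMENTARY REPLACEMENT, valid over any commutative ring
`Λ` with a distinguished element `x` (read: `T`) and elements `φ_i` (read: `Φ_{p^i}(1+T)`), for the
tree's formalisation of Thm. 1.12 (`Sprung2017.thm112_exists_isSprungPair`, vendored in
`SharpFlatPAdicLFunction.lean`; discharged in `SharpFlatExistenceProofs.lean`):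

Let `u_n, v_n` be the solutions of `s_{n+2} = a s_{n+1} − φ_{n+1} s_n` with `(u_0,u_1) = (0,1)`,
`(v_0,v_1) = (1,0)` (`rec₂`; these are `sharpPoly`, `flatPoly`), `Π_n = φ_1⋯φ_n`, `ω_n = x·Π_n`.
* `wronskian` — `u_{n+1} v_n − u_n v_{n+1} = Π_n` (so `det 𝒞_1⋯𝒞_nÃ⁻¹ = ω_n/T`);
* `rec₂_eq` — every solution `G` of the recursion is `G_n = G_1 u_n + G_0 v_n`;
* given `Θ, d : ℕ → Λ` with the queue relation WITH DEFECTS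
  `Θ_{n+2} = a Θ_{n+1} − φ_{n+1} Θ_n + ω_{n+1} d_{n+2}` (the tree's three-term relation of Mazur–Tate
  elements holds modulo `ω_{n+1}`), the EXPLICIT vectors `ups K` (`= Υ_{K+1}`):
  `Υ_1 = (Θ_1, Θ_0)`, `Υ_{K+2} = Υ_{K+1} + x·d_{K+2}·(v_{K+1}, −u_{K+1})`, satisfy EXACTLY
  `Θ_{K+1} = Υ_{K+1}·(u_{K+1}, v_{K+1})` and `Θ_K = Υ_{K+1}·(u_K, v_K)` (`ups_spec` — Cor. 4.4 at
  level `K+1`, both columns), and for every lower level `n ≤ K+1`,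
  `Θ_n − Υ_{K+1}·(u_n, v_n) ∈ ω_n Λ` (`ups_tail`: the generalised Wronskians
  `u_n v_k − v_n u_k`, `k ≥ n`, lie in `Π_n Λ`, `cross_mem`).
So each `Υ_{K+1}` satisfies ALL level congruences `n ≤ K + 1` simultaneously; the increments
`x d_{K+2}(v_{K+1}, −u_{K+1})` tend to zero `(p,T)`-adically when `p ∣ a_p` (next file), and the
limit is Sprung's pair. No roots of unity, no `α, β`, no `𝓛og`. [cite: Sprung2017, Prop. 4.1, Cor. 4.4 and Thm. 1.12]

All statements are [folklore]-level commutative algebra; they carry the Sprung citation because they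
formalise (a proof of) his Cor. 4.4 / Thm. 1.12. Cell `b2b-bsdres`, X8 prover B (gen 3).
-/

set_option autoImplicit false

namespace Literature.NumberTheory.EllipticCurves.Sprung2017.Tandem

variable {Λ : Type*} [CommRing Λ]

/-! ### The two-term recursion -/

/-- The recursion `s_0 = s₀`, `s_1 = s₁`, `s_{n+2} = a·s_{n+1} − φ_{n+1}·s_n` over a commutative ring
(Sprung's queue relation / the first column of `𝒞_1⋯𝒞_nÃ⁻¹`). [cite: Sprung2017, Def. 1.7 and Cor. 4.4] -/
def rec₂ (a : Λ) (φ : ℕ → Λ) (s₀ s₁ : Λ) : ℕ → Λ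
  | 0 => s₀
  | 1 => s₁
  | n + 2 => a * rec₂ a φ s₀ s₁ (n + 1) - φ (n + 1) * rec₂ a φ s₀ s₁ n

section Rec

variable (a : Λ) (φ : ℕ → Λ) (s₀ s₁ : Λ)

/-- `s_0`. [cite: Sprung2017, Cor. 4.4] -/
@[simp] theorem rec₂_zero : rec₂ a φ s₀ s₁ 0 = s₀ := rfl

/-- `s_1`. [cite: Sprung2017, Cor. 4.4] -/
@[simp] theorem rec₂_one : rec₂ a φ s₀ s₁ 1 = s₁ := rfl

/-- `s_{n+2} = a s_{n+1} − φ_{n+1} s_n`. [cite: Sprung2017, Cor. 4.4] -/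
theorem rec₂_add_two (n : ℕ) :
    rec₂ a φ s₀ s₁ (n + 2) = a * rec₂ a φ s₀ s₁ (n + 1) - φ (n + 1) * rec₂ a φ s₀ s₁ n := rfl

/-- **Every solution of the recursion is a combination of the two basic ones**: if
`G_{n+2} = a G_{n+1} − φ_{n+1} G_n` then `G_n = G_1·u_n + G_0·v_n` with `u = rec₂ a φ 0 1`,
`v = rec₂ a φ 1 0`. [cite: Sprung2017, Cor. 4.4] -/
theorem rec₂_eq (G : ℕ → Λ) (hG : ∀ n, G (n + 2) = a * G (n + 1) - φ (n + 1) * G n) (n : ℕ) :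
    G n = G 1 * rec₂ a φ 0 1 n + G 0 * rec₂ a φ 1 0 n := by
  induction n using Nat.strong_induction_on with
  | _ n ih =>
    match n with
    | 0 => simp
    | 1 => simp
    | n + 2 =>
      rw [hG n, ih (n + 1) (by omega), ih n (by omega), rec₂_add_two, rec₂_add_two]
      ring

/-- A solution with `G_0 = G_1 = 0` vanishes identically. [cite: Sprung2017, Cor. 4.4] -/
theorem rec₂_zero_zero (n : ℕ) : rec₂ a φ 0 0 n = 0 := by
  rw [rec₂_eq a φ (rec₂ a φ 0 0) (rec₂_add_two a φ 0 0) n, rec₂_one, rec₂_zero, zero_mul,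
    zero_mul, add_zero]

end Rec

/-! ### The products `Π_n = φ_1⋯φ_n` and the Wronskian -/

section Wronskian

variable (a : Λ) (φ : ℕ → Λ)

/-- `Π_n = ∏_{i=1}^{n} φ_i` (read: `ω_n/T = ∏_{i ≤ n} Φ_{p^i}(1+T)`). [cite: Sprung2017, Remark 3.1 (det 𝓛og)] -/
def prodPhi (n : ℕ) : Λ := ∏ i ∈ Finset.range n, φ (i + 1)

/-- `Π_0 = 1`. [cite: Sprung2017, Remark 3.1] -/
@[simp] theorem prodPhi_zero : prodPhi φ 0 = 1 := by simp [prodPhi]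

/-- `Π_{n+1} = Π_n · φ_{n+1}`. [cite: Sprung2017, Remark 3.1] -/
theorem prodPhi_succ (n : ℕ) : prodPhi φ (n + 1) = prodPhi φ n * φ (n + 1) := by
  rw [prodPhi, Finset.prod_range_succ, prodPhi]

/-- **Wronskian**: `u_{n+1} v_n − u_n v_{n+1} = Π_n` (the determinant of `𝒞_1⋯𝒞_nÃ⁻¹` is
`∏ Φ_{p^i}(1+T) = ω_n/T`). [cite: Sprung2017, Remark 3.1 and Cor. 4.4] -/
theorem wronskian (n : ℕ) :
    rec₂ a φ 0 1 (n + 1) * rec₂ a φ 1 0 n - rec₂ a φ 0 1 n * rec₂ a φ 1 0 (n + 1) = prodPhi φ n := by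
  induction n with
  | zero => simp
  | succ n ih =>
    rw [prodPhi_succ, ← ih, rec₂_add_two, rec₂_add_two]
    ring

/-- **Generalised Wronskians are multiples of `Π_n`**: for `k ≥ n`,
`u_n·v_k − v_n·u_k ∈ Π_n·Λ` — as a function of `k` it solves the recursion, vanishes at `k = n` and
equals `−Π_n` at `k = n+1`. Stated with `k = n + i`: there is `g_i` (itself given by the shifted
recursion, `cross_eq_prodPhi_mul`) with `u_n v_{n+i} − v_n u_{n+i} = Π_n · g_i`.
[cite: Sprung2017, Cor. 4.4 and Cor. 4.5] -/
theorem cross_eq_prodPhi_mul (n i : ℕ) :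
    rec₂ a φ 0 1 n * rec₂ a φ 1 0 (n + i) - rec₂ a φ 1 0 n * rec₂ a φ 0 1 (n + i) =
      prodPhi φ n * rec₂ a (fun m ↦ φ (n + m)) 0 (-1) i := by
  induction i using Nat.strong_induction_on with
  | _ i ih =>
    match i with
    | 0 =>
      simp only [Nat.add_zero, rec₂_zero, mul_zero]
      ring
    | 1 =>
      rw [rec₂_one, mul_neg, mul_one, ← wronskian a φ n]
      ring
    | i + 2 =>
      have h1 := ih (i + 1) (by omega)
      have h0 := ih i (by omega)
      rw [show n + (i + 2) = (n + i) + 2 from by ring, rec₂_add_two, rec₂_add_two, rec₂_add_two,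
        show n + i + 1 = n + (i + 1) from by ring]
      linear_combination a * h1 - φ (n + (i + 1)) * h0

end Wronskian

/-! ### The explicit Tandem vectors `Υ_{K+1} = ups K` -/

section Ups

variable (a x : Λ) (φ : ℕ → Λ) (Θ d : ℕ → Λ)

/-- **The Tandem vectors**, explicitly: `ups K = Υ_{K+1} ∈ Λ²` with `Υ_1 = (Θ_1, Θ_0)` and
`Υ_{K+2} = Υ_{K+1} + x·d_{K+2}·(v_{K+1}, −u_{K+1})` (`u = rec₂ a φ 0 1`, `v = rec₂ a φ 1 0`).
[cite: Sprung2017, Prop. 4.1 and Cor. 4.4] -/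
def ups : ℕ → Λ × Λ
  | 0 => (Θ 1, Θ 0)
  | K + 1 => ups K +
      (x * d (K + 2) * rec₂ a φ 1 0 (K + 1), -(x * d (K + 2) * rec₂ a φ 0 1 (K + 1)))

/-- `Υ_1 = (Θ_1, Θ_0)`. [cite: Sprung2017, Cor. 4.4] -/
@[simp] theorem ups_zero : ups a x φ Θ d 0 = (Θ 1, Θ 0) := rfl

/-- `Υ_{K+2} = Υ_{K+1} + x d_{K+2} (v_{K+1}, −u_{K+1})`. [cite: Sprung2017, Cor. 4.4] -/
theorem ups_succ (K : ℕ) : ups a x φ Θ d (K + 1) = ups a x φ Θ d K +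
    (x * d (K + 2) * rec₂ a φ 1 0 (K + 1), -(x * d (K + 2) * rec₂ a φ 0 1 (K + 1))) := rfl

variable {a x φ Θ d}

/-- **Cor. 4.4 at every level, exactly.** If `Θ` satisfies the queue relation with defects
`Θ_{n+2} = a Θ_{n+1} − φ_{n+1} Θ_n + (x Π_{n+1}) d_{n+2}` (`ω_{n+1} = x·Π_{n+1}`), then for every
`K`: `Θ_{K+1} = Υ_{K+1}·(u_{K+1}, v_{K+1})` and `Θ_K = Υ_{K+1}·(u_K, v_K)` — i.e.
`(Θ_{K+1}, φ_{K+1}Θ_K) = Υ_{K+1}·M_{K+1}` with `M = 𝒞_1⋯𝒞_{K+1}Ã⁻¹` (both columns).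
[cite: Sprung2017, Prop. 4.1 and Cor. 4.4] -/
theorem ups_spec
    (hΘ : ∀ n, Θ (n + 2) = a * Θ (n + 1) - φ (n + 1) * Θ n + x * prodPhi φ (n + 1) * d (n + 2))
    (K : ℕ) :
    Θ (K + 1) = (ups a x φ Θ d K).1 * rec₂ a φ 0 1 (K + 1) + (ups a x φ Θ d K).2 * rec₂ a φ 1 0 (K + 1) ∧
      Θ K = (ups a x φ Θ d K).1 * rec₂ a φ 0 1 K + (ups a x φ Θ d K).2 * rec₂ a φ 1 0 K := by
  induction K with
  | zero => simp
  | succ K ih =>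
    obtain ⟨ih1, ih0⟩ := ih
    have hW := wronskian a φ (K + 1)
    have hu := rec₂_add_two a φ 0 1 K
    have hv := rec₂_add_two a φ 1 0 K
    refine ⟨?_, ?_⟩
    · rw [show K + 1 + 1 = K + 2 from rfl, hΘ K, ih1, ih0, hu, hv, ups_succ, Prod.fst_add,
        Prod.snd_add]
      rw [show K + 1 + 1 = K + 2 from rfl] at hW
      rw [hu, hv] at hW
      linear_combination (-(x * d (K + 2))) * hW
    · rw [ups_succ, Prod.fst_add, Prod.snd_add, ih1]
      ring

/-- **All lower levels at once.** Under the queue relation with defects, for `n ≤ K + 1` the vector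
`Υ_{K+1}` satisfies the level-`n` congruence EXACTLY modulo `ω_n = x·Π_n`:
`Θ_n − Υ_{K+1}·(u_n, v_n) ∈ (x Π_n)·Λ`. (Each increment `x d_{k+2}(v_{k+1}, −u_{k+1})` pairs with
`(u_n, v_n)` to `x d_{k+2}(v_{k+1}u_n − u_{k+1}v_n) ∈ x Π_n Λ` by `cross_eq_prodPhi_mul`.)
[cite: Sprung2017, Cor. 4.4, Cor. 4.5 and the proof of Thm. 1.12] -/
theorem ups_tail
    (hΘ : ∀ n, Θ (n + 2) = a * Θ (n + 1) - φ (n + 1) * Θ n + x * prodPhi φ (n + 1) * d (n + 2))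
    (K n : ℕ) (hn : n ≤ K + 1) :
    ∃ q : Λ, Θ n - ((ups a x φ Θ d K).1 * rec₂ a φ 0 1 n + (ups a x φ Θ d K).2 * rec₂ a φ 1 0 n) =
      x * prodPhi φ n * q := by
  induction K with
  | zero =>
    interval_cases n <;> exact ⟨0, by simp⟩
  | succ K ih =>
    rcases Nat.lt_or_ge n (K + 2) with hlt | hge
    · -- `n ≤ K + 1`: previous vector plus an increment in `x Π_n Λ`
      obtain ⟨q, hq⟩ := ih (by omega)
      obtain ⟨i, hi⟩ : ∃ i, K + 1 = n + i := ⟨K + 1 - n, by omega⟩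
      have hcross : rec₂ a φ 0 1 n * rec₂ a φ 1 0 (K + 1) - rec₂ a φ 1 0 n * rec₂ a φ 0 1 (K + 1) =
          prodPhi φ n * rec₂ a (fun m ↦ φ (n + m)) 0 (-1) i := by
        rw [hi]
        exact cross_eq_prodPhi_mul a φ n i
      refine ⟨q - d (K + 2) * rec₂ a (fun m ↦ φ (n + m)) 0 (-1) i, ?_⟩
      rw [ups_succ, Prod.fst_add, Prod.snd_add]
      linear_combination hq - x * d (K + 2) * hcross
    · -- `n = K + 2`: the top level, exact
      have hn2 : n = K + 2 := by omega
      subst hn2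
      exact ⟨0, by rw [(ups_spec hΘ (K + 1)).1]; ring⟩

/-- The increments of the Tandem vectors: `Υ_{K+2} − Υ_{K+1} = x·d_{K+2}·(v_{K+1}, −u_{K+1})`
(componentwise). [cite: Sprung2017, Cor. 4.4] -/
theorem ups_succ_sub (K : ℕ) :
    (ups a x φ Θ d (K + 1)).1 - (ups a x φ Θ d K).1 = x * d (K + 2) * rec₂ a φ 1 0 (K + 1) ∧
      (ups a x φ Θ d (K + 1)).2 - (ups a x φ Θ d K).2 = -(x * d (K + 2) * rec₂ a φ 0 1 (K + 1)) := by
  rw [ups_succ, Prod.fst_add, Prod.snd_add]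
  exact ⟨by ring, by ring⟩

end Ups

/-! ### `𝔪`-adic smallness of the recursion when `a, φ_i ∈ 𝔪` -/

section Small

variable {a : Λ} {φ : ℕ → Λ} (𝔪 : Ideal Λ)

/-- If `a ∈ 𝔪` and every `φ_i ∈ 𝔪` (read: `p ∣ a_p` and `Φ_{p^i}(1+T) ∈ (p, T)`), then the basic
solutions satisfy `u_n, v_n ∈ 𝔪^{⌊n/2⌋}` — more generally any solution with `s₀, s₁ ∈ Λ` has
`s_{n} ∈ 𝔪^{⌊n/2⌋}` for `n ≥ 2`... stated as: `s_{2k+2}, s_{2k+3} ∈ 𝔪^{k+1}`, `s_2, s_3 ∈ 𝔪`; we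
prove the uniform form `s_n ∈ 𝔪 ^ ((n - 1) / 2)` hmm — precisely: `rec₂ a φ s₀ s₁ (n + 2) ∈ 𝔪 ^ (n / 2 + 1)`.
[cite: Sprung2017, §4 "Proposition (yeah)" (𝔐 = 0 in the supersingular case)] -/
theorem rec₂_mem_pow (ha : a ∈ 𝔪) (hφ : ∀ i, φ i ∈ 𝔪) (s₀ s₁ : Λ) (n : ℕ) :
    rec₂ a φ s₀ s₁ (n + 2) ∈ 𝔪 ^ (n / 2 + 1) := by
  -- strengthen: levels `n+2` and `n+3` together
  suffices h : ∀ k, rec₂ a φ s₀ s₁ (2 * k + 2) ∈ 𝔪 ^ (k + 1) ∧ rec₂ a φ s₀ s₁ (2 * k + 3) ∈ 𝔪 ^ (k + 1) by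
    obtain ⟨k, hk⟩ := Nat.even_or_odd' n
    rcases hk with rfl | rfl
    · rw [show 2 * k / 2 = k from by omega]
      exact (h k).1
    · rw [show (2 * k + 1) / 2 = k from by omega, show 2 * k + 1 + 2 = 2 * k + 3 from by ring]
      exact (h k).2
  intro k
  induction k with
  | zero =>
    refine ⟨?_, ?_⟩
    · rw [Nat.mul_zero, Nat.zero_add, pow_one, rec₂_add_two]
      exact 𝔪.sub_mem (𝔪.mul_mem_right _ ha) (𝔪.mul_mem_right _ (hφ 1))
    · rw [Nat.mul_zero, Nat.zero_add, pow_one, rec₂_add_two]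
      exact 𝔪.sub_mem (𝔪.mul_mem_right _ ha) (𝔪.mul_mem_right _ (hφ 2))
  | succ k ih =>
    obtain ⟨h2, h3⟩ := ih
    have h4 : rec₂ a φ s₀ s₁ (2 * (k + 1) + 2) ∈ 𝔪 ^ (k + 1 + 1) := by
      rw [show 2 * (k + 1) + 2 = (2 * k + 2) + 2 from by ring, rec₂_add_two, pow_succ',
        show 2 * k + 2 + 1 = 2 * k + 3 from by ring]
      exact Ideal.sub_mem _ (Ideal.mul_mem_mul ha h3) (Ideal.mul_mem_mul (hφ _) h2)
    refine ⟨h4, ?_⟩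
    rw [show 2 * (k + 1) + 3 = (2 * k + 3) + 2 from by ring, rec₂_add_two, pow_succ',
      show 2 * k + 3 + 1 = 2 * (k + 1) + 2 from by ring]
    refine Ideal.sub_mem _ ?_ (Ideal.mul_mem_mul (hφ _) h3)
    exact Ideal.mul_mono_right (Ideal.pow_le_pow_right (Nat.le_succ _)) (Ideal.mul_mem_mul ha h4)

end Small

end Literature.NumberTheory.EllipticCurves.Sprung2017.Tandem
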